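import Summits.PneNP.PneNP.Theorems.NegLimitedGapPerfectMatchingQuasipoly
import Summits.PneNP.PneNP.Theorems.NegLimitedGapPMCorollaries
import HarnessLib

/-!
# Route NegLimited — CGRSS Theorem 1 and the Karchmer–Wigderson corollary DISCHARGED (line `r7-crosscut`, rung F-N1/p3)

With T5⁺ now a theorem of the tree (`NegLimitedGapPM.gapPerfectMatchingExp_holds`,
`NegLimitedGapPerfectMatchingQuasipoly.lean`, which closed item T5 = stmt-PneNP-19861), the two
implications of `NegLimitedGapPMCorollaries.lean` (ROUND-7 §2, R7-S2 / R7-S4) are discharged: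

* `CavalarEtAl2026_perfectMatching_holds` — **CGRSS Theorem 1** (Cavalar–Göös–Riazanov–Sofronova–
  Sokolov, *Monotone Circuit Complexity of Matching*, STOC 2026, arXiv:2507.16105, Thm. 1):
  `2^{n^{1/3-δ}} ≤ circuitSizeOver monotoneBasis (perfectMatchingFn n)` for all large `n`.  The named
  fact `Literature.Computability.Complexity.CavalarEtAl2026_perfectMatching` of
  `Literature/Computability/Complexity/MatchingSunflowers.lean` is thereby PROVED in the tree (through
  the gap-robust engine: biased matching sunflowers + the CKR closure calculus on the `1/8`-biased
  cross-cut measure), together with its corollaries `.two_pow_rpow` / `.one_fourth` stated there.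
* `gapPMProtocolDepthPoly_holds` — the **Karchmer–Wigderson corollary** `GapPMProtocolDepthPoly`:
  every deterministic protocol for the gapped Raz–Wigderson game `GPA_K` (Alice: a graph with a perfect
  matching, Bob: a `K`-deficient graph; name an edge of Alice's graph missing from Bob's) has depth
  `≥ m^{1/3-δ}` eventually (statement = `turnkey-R7/add_items.json` item `GapPMProtocolDepthPoly`).
-/

set_option linter.dupNamespace false -- `Summit.PneNP.PneNP.…`: summit = sub-problem name (D-0017 single-conjunct layout)

namespace Summit.PneNP.PneNP.Theorems.NegLimitedGapPM

open Literature.Computability.Complexity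

/-- **CGRSS Theorem 1 PROVED** (arXiv:2507.16105, Thm. 1; the tree's named fact
`CavalarEtAl2026_perfectMatching` discharged): for every `δ > 0`, for all large `n`, every monotone
circuit computing the perfect matching function of `K_{n,n}` has at least `2^{n^{1/3-δ}}` gates. -/
theorem CavalarEtAl2026_perfectMatching_holds : CavalarEtAl2026_perfectMatching :=
  gapExp_implies_thm1 gapPerfectMatchingExp_holds

/-- The `2^{n^{Ω(1)}}` shape of CGRSS Theorem 1, unconditionally (`c = 1/6`). -/
theorem two_pow_rpow_le_circuitSizeOver_perfectMatchingFn :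
    ∃ c : ℝ, 0 < c ∧ ∀ᶠ n : ℕ in Filter.atTop,
      (2 : ℝ) ^ ((n : ℝ) ^ c) ≤ circuitSizeOver monotoneBasis (Literature.Barriers.PneNP.perfectMatchingFn n) :=
  CavalarEtAl2026_perfectMatching_holds.two_pow_rpow

/-- **The Karchmer–Wigderson corollary PROVED** (R7-S4): deterministic protocols for the gapped
Raz–Wigderson game `GPA_K` have depth `≥ m^{1/3-δ}` eventually, for every `K ≥ 2`, `δ > 0`. -/
theorem gapPMProtocolDepthPoly_holds : GapPMProtocolDepthPoly :=
  gapExp_implies_protocolDepthPoly gapPerfectMatchingExp_holds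

end Summit.PneNP.PneNP.Theorems.NegLimitedGapPM
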